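import Literature.NumberTheory.EllipticCurves.AnticyclotomicPrimeDecompositionAnyPrimeProofs
import Literature.NumberTheory.EllipticCurves.StrictSelmerRankOneDegreeOneProofs
import Literature.NumberTheory.EllipticCurves.HeegnerPoints
import HarnessLib

/-!
# Under the Heegner hypothesis, the places dividing `pN` are finitely decomposed in the anticyclotomic tower
# (theorems only)

`Proofs` file (theorems only; no definition, no named fact, no instance, no `sorry`).  Topic `NumberTheory/EllipticCurves`
(cell `pub/bsd-print-x9`; the hypothesis `hdec : ¬ D_v ≤ Gal(K̄/K_∞)` consumed at EVERY `v ∈ S` by the local bricks of the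
shared μ-crux's STUB A — (N1) `exists_forall_pow_smul_galoisCohomology_one_toLocal_eq_zero[_uniform]`, H.5(b) at `v ∈ S ∖ {p}`
(`eisensteinDVRSetting_h5b_clause_zero_of_mem_of_not_decomp_le`), (B4)
`exists_forall_natCast_smul_invariants_of_not_decomp_le` — discharged from the FRAME: `K` imaginary quadratic, `κ`
anticyclotomic, the Heegner hypothesis for `N`, and `v ∣ pN`; seat `bsd-line-x10b-p1-w5` g2).

Brink 2007 (tree: `ZpExtension.decomp_not_le_kerSubgroup_above_of_isAnticyclotomic_anyPrime` for `v ∣ p`,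
`ZpExtension.decomp_not_le_kerSubgroup_of_isAnticyclotomic_anyPrime` for a degree-one `v ∤ p`): the primes above `p` and the
primes of degree one are finitely decomposed in the anticyclotomic `ℤ_p`-extension of an imaginary quadratic field.  Under the
Heegner hypothesis «every prime `ℓ ∣ N` splits in `K`» every place `v ∋ N` has degree one (`ℓ ∣ N` for the rational prime `ℓ`
below `v`; two primes above `ℓ` in a quadratic field force `e = f = 1`, tree
`ramificationIdx_eq_one_and_inertiaDeg_eq_one_of_ncard_primesOver_eq_two`).  Hence:

* `Ideal.exists_prime_dvd_and_natCast_mem` — a prime ideal containing `(N : R)`, `N ≠ 0`, contains some prime factor of `N`;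
* `ramificationIdx_eq_one_and_inertiaDeg_eq_one_of_natCast_mem_of_satisfiesHeegnerHypothesis` — `v ∋ N` has degree one;
* **`ZpExtension.decomp_not_le_kerSubgroup_of_natCast_mem_of_satisfiesHeegnerHypothesis`** — `v ∋ N`, `v ∌ p` ⇒ `¬ D_v ≤ ker κ`;
* **`ZpExtension.decomp_not_le_kerSubgroup_of_mem_or_mem`** — the binder shape of the D1 assembly
  (`hSN : ∀ v ∈ S, p ∈ v ∨ N ∈ v` ⇒ `∀ v ∈ S, ¬ D_v ≤ ker κ`).

No summit statement is proved; BSD is not proved by any of this.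

References: [Brink2007] D. Brink, *Prime decomposition in the anti-cyclotomic extension*, Math. Comp. 76 (2007), Thm. 2 and
Cor. 1; [CasselsFrohlich1967] Ch. I §10 Prop. 1 (`Σ e f = n`); [Gross1991] B. Gross, *Kolyvagin's work on modular elliptic
curves*, §1 (the Heegner hypothesis); [Washington1997] §13.1.
-/

set_option autoImplicit false

noncomputable section

open scoped Classical
open NumberField IsDedekindDomain

/-! ## A prime ideal containing `N` contains a prime factor of `N` -/

/-- A prime ideal containing the image of a non-zero natural number `N` contains the image of some prime factor of `N`.
[cite: CasselsFrohlich1967, Ch. I §10 (folklore)] -/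
theorem Ideal.exists_prime_dvd_and_natCast_mem {R : Type*} [CommSemiring R] (I : Ideal R) [hI : I.IsPrime] :
    ∀ {N : ℕ}, N ≠ 0 → (N : R) ∈ I → ∃ ℓ : ℕ, ℓ.Prime ∧ ℓ ∣ N ∧ (ℓ : R) ∈ I := by
  intro N
  induction N using Nat.strong_induction_on with
  | _ N ih =>
    intro hN0 hN
    by_cases h1 : N = 1
    · subst h1
      exact absurd ((Ideal.eq_top_iff_one I).2 (by simpa using hN)) hI.ne_top
    · have hmin : N.minFac.Prime := Nat.minFac_prime h1
      have hdvd : N.minFac ∣ N := Nat.minFac_dvd N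
      obtain ⟨M, hM⟩ := hdvd
      have hcast : (N : R) = (N.minFac : R) * (M : R) := by rw [← Nat.cast_mul, ← hM]
      rw [hcast] at hN
      rcases hI.mem_or_mem hN with hℓ | hMmem
      · exact ⟨N.minFac, hmin, ⟨M, hM⟩, hℓ⟩
      · have hM0 : M ≠ 0 := fun h ↦ hN0 (by rw [hM, h, mul_zero])
        have hMlt : M < N := by
          rw [hM]
          exact lt_mul_left (Nat.pos_of_ne_zero hM0) hmin.one_lt
        obtain ⟨ℓ, hℓ, hℓM, hℓI⟩ := ih M hMlt hM0 hMmem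
        exact ⟨ℓ, hℓ, hℓM.trans (Dvd.intro_left N.minFac hM.symm), hℓI⟩

namespace Literature.NumberTheory.EllipticCurves

variable {K : Type} [Field K] [NumberField K]

/-- **Under the Heegner hypothesis every place `v ∋ N` has degree one**: the rational prime `ℓ` below `v` divides `N`, so
`ℓ` splits in the quadratic field `K`, so `e(v|ℓ) = f(v|ℓ) = 1`. [cite: Gross1991, §1 (the Heegner hypothesis)]
[cite: CasselsFrohlich1967, Ch. I §10 Prop. 1] -/
theorem ramificationIdx_eq_one_and_inertiaDeg_eq_one_of_natCast_mem_of_satisfiesHeegnerHypothesis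
    (hK2 : Module.finrank ℚ K = 2) {N : ℕ} (hHeeg : SatisfiesHeegnerHypothesis N K) (hN0 : N ≠ 0)
    (v : HeightOneSpectrum (𝓞 K)) (hNv : ((N : ℕ) : 𝓞 K) ∈ v.asIdeal) :
    v.asIdeal.ramificationIdx (𝓞 ℚ) = 1 ∧ v.asIdeal.inertiaDeg (𝓞 ℚ) = 1 := by
  obtain ⟨ℓ, hℓ, hℓN, hℓv⟩ := v.asIdeal.exists_prime_dvd_and_natCast_mem hN0 hNv
  haveI : Fact ℓ.Prime := ⟨hℓ⟩
  exact ramificationIdx_eq_one_and_inertiaDeg_eq_one_of_ncard_primesOver_eq_two ℓ hK2 (hHeeg ℓ hℓ hℓN) v hℓv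

namespace ZpExtension

variable {p : ℕ} [Fact p.Prime]

/-- **A place `v ∋ N`, `v ∌ p`, is finitely decomposed in the anticyclotomic `ℤ_p`-extension** (`¬ D_v ≤ Gal(K̄/K_∞)`), for `K`
imaginary quadratic satisfying the Heegner hypothesis for `N`: `v` has degree one (previous lemma) and Brink's theorem applies
(tree `decomp_not_le_kerSubgroup_of_isAnticyclotomic_anyPrime`). [cite: Brink2007, Thm. 2 and Cor. 1] [cite: Gross1991, §1] -/
theorem decomp_not_le_kerSubgroup_of_natCast_mem_of_satisfiesHeegnerHypothesis (hK : IsImaginaryQuadratic K)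
    (κ : ZpExtension K p) (hκ : κ.IsAnticyclotomic) {N : ℕ} (hHeeg : SatisfiesHeegnerHypothesis N K) (hN0 : N ≠ 0)
    (v : HeightOneSpectrum (𝓞 K)) (hpv : ((p : ℕ) : 𝓞 K) ∉ v.asIdeal) (hNv : ((N : ℕ) : 𝓞 K) ∈ v.asIdeal) :
    ¬ (GreenbergSelmer.decomp v ≤ κ.kerSubgroup) := by
  obtain ⟨he, hf⟩ :=
    ramificationIdx_eq_one_and_inertiaDeg_eq_one_of_natCast_mem_of_satisfiesHeegnerHypothesis hK.1 hHeeg hN0 v hNv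
  exact decomp_not_le_kerSubgroup_of_isAnticyclotomic_anyPrime K p hK κ hκ v hpv he hf

/-- **Every place of `S` is finitely decomposed in `K_∞`**, in the binder shape of the D1 assembly of the shared μ-crux
(`hSN : ∀ v ∈ S, p ∈ v ∨ N ∈ v`): above `p` by Brink's Cor. 1 (tree `decomp_not_le_kerSubgroup_above_of_isAnticyclotomic_anyPrime`),
at `v ∋ N` by the Heegner hypothesis. [cite: Brink2007, Thm. 2 and Cor. 1] [cite: Gross1991, §1] [cite: Washington1997, §13.1] -/
theorem decomp_not_le_kerSubgroup_of_mem_or_mem (hK : IsImaginaryQuadratic K) (κ : ZpExtension K p)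
    (hκ : κ.IsAnticyclotomic) {N : ℕ} (hHeeg : SatisfiesHeegnerHypothesis N K) (hN0 : N ≠ 0)
    {S : Finset (HeightOneSpectrum (𝓞 K))}
    (hSN : ∀ v ∈ S, ((p : ℕ) : 𝓞 K) ∈ v.asIdeal ∨ ((N : ℕ) : 𝓞 K) ∈ v.asIdeal) :
    ∀ v ∈ S, ¬ (GreenbergSelmer.decomp v ≤ κ.kerSubgroup) := by
  intro v hv
  by_cases hpv : ((p : ℕ) : 𝓞 K) ∈ v.asIdeal
  · exact decomp_not_le_kerSubgroup_above_of_isAnticyclotomic_anyPrime K p hK κ hκ v hpv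
  · exact decomp_not_le_kerSubgroup_of_natCast_mem_of_satisfiesHeegnerHypothesis hK κ hκ hHeeg hN0 v hpv
      ((hSN v hv).resolve_left hpv)

/-- The same for a single place given as `p ∈ v ∨ N ∈ v`. [cite: Brink2007, Thm. 2 and Cor. 1] [cite: Gross1991, §1] -/
theorem decomp_not_le_kerSubgroup_of_mem_or_natCast_mem (hK : IsImaginaryQuadratic K) (κ : ZpExtension K p)
    (hκ : κ.IsAnticyclotomic) {N : ℕ} (hHeeg : SatisfiesHeegnerHypothesis N K) (hN0 : N ≠ 0)
    (v : HeightOneSpectrum (𝓞 K)) (hv : ((p : ℕ) : 𝓞 K) ∈ v.asIdeal ∨ ((N : ℕ) : 𝓞 K) ∈ v.asIdeal) :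
    ¬ (GreenbergSelmer.decomp v ≤ κ.kerSubgroup) := by
  by_cases hpv : ((p : ℕ) : 𝓞 K) ∈ v.asIdeal
  · exact decomp_not_le_kerSubgroup_above_of_isAnticyclotomic_anyPrime K p hK κ hκ v hpv
  · exact decomp_not_le_kerSubgroup_of_natCast_mem_of_satisfiesHeegnerHypothesis hK κ hκ hHeeg hN0 v hpv
      (hv.resolve_left hpv)

end ZpExtension

end Literature.NumberTheory.EllipticCurves

end
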